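import Summits.QuantumFields.YangMills.Theorems.ParabolicTrajectoryLatticeGapOnTrajectoryDefs
import Literature.MathematicalPhysics.QuantumFieldTheory.LatticeGaugeProofs
import HarnessLib

/-!
# Crux `LatticeGapOnTrajectory` (stmt-QuantumFields-10523), line `sparse-defect-orbit-window`:
# stub (M) `stub_largeFieldCountEvent` — the large-field COUNT event is measurable and cell-local

Registered stub (M) of the line skeleton, `--supports stmt-QuantumFields-10523` (G-blind tool;
nothing about mass gaps is asserted, everything here is proved).

For a finite plaquette set `P` all of whose plaquettes `p = (y, i < j)` have the three sites
`y`, `y + eᵢ`, `y + eⱼ` in the cell `x` of an axis-frame family `q`, the COUNT event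
"at least `m` plaquettes of `P` are `ε₀`-large",
`{U | ∃ Y ⊆ P, m ≤ |Y| ∧ ∀ p ∈ Y, ε₀ ≤ N − Re tr r(U_p)}`,
is (i) measurable and (ii) read on the cell `x`.

Proof. (i) The event is the finite union over `Y ∈ 𝒫(P)` with `m ≤ |Y|` of the finite
intersections over `p ∈ Y` of the events `{ε₀ ≤ N − Re tr r(U_p)}`, each measurable since
`U ↦ U_p` is measurable (`measurable_plaquetteHolonomy`; `G` is second countable because the
faithful representation `r.ρ` is a closed embedding into matrices) and `g ↦ Re tr r(g)` is
continuous (`continuous_trace_re`). (ii) The four links `(y, i)`, `(y + eᵢ, j)`, `(y + eⱼ, i)`,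
`(y, j)` of `p` are based at sites labelled `x`, so two configurations agreeing on the links
labelled `x` have the same holonomy `U_p` for every `p ∈ P`, hence lie in the event together.
-/

set_option autoImplicit false

noncomputable section

namespace Summit.QuantumFields.YangMills.Cruxes.LatticeGapOnTrajectory.SparseDefectOrbitWindow

open MeasureTheory
open Literature.MathematicalPhysics.QuantumFieldTheory
open Summit.QuantumFields.YangMills.Cruxes.LatticeGapOnTrajectory.OrbitKantorovichFiniteSize

namespace StubLargeFieldCountEvent

/-! ### Count events over a finite index set are measurable -/

/-- **Count events are measurable.** For a finite index set `P` and events `A p` measurable for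
`p ∈ P`, the event "at least `m` of the `A p`, `p ∈ P`, occur"
(`∃ Y ⊆ P, m ≤ |Y| ∧ ∀ p ∈ Y, A p`) is measurable: it is the finite union over the `Y ⊆ P` with
`m ≤ |Y|` of the finite intersections `⋂ p ∈ Y, A p`. -/
theorem measurableSet_count {α ι : Type*} [MeasurableSpace α] (P : Finset ι) (m : ℕ)
    (A : ι → α → Prop) (hA : ∀ p ∈ P, MeasurableSet {a | A p a}) :
    MeasurableSet {a : α | ∃ Y ⊆ P, m ≤ Y.card ∧ ∀ p ∈ Y, A p a} := by
  have hset : {a : α | ∃ Y ⊆ P, m ≤ Y.card ∧ ∀ p ∈ Y, A p a} =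
      ⋃ Y ∈ P.powerset.filter (fun Y => m ≤ Y.card), ⋂ p ∈ Y, {a | A p a} := by
    ext a
    simp only [Set.mem_setOf_eq, Set.mem_iUnion, Set.mem_iInter, Finset.mem_filter,
      Finset.mem_powerset, exists_prop, and_assoc]
  rw [hset]
  exact Finset.measurableSet_biUnion _ fun Y hY =>
    Finset.measurableSet_biInter _ fun p hp =>
      hA p ((Finset.mem_powerset.1 (Finset.mem_filter.1 hY).1) hp)

/-! ### The plaquette defect `N − Re tr r(U_p)` is measurable and read on the cell of `p` -/

variable {G : Type} [Group G] [TopologicalSpace G] [IsTopologicalGroup G] [CompactSpace G]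
  [MeasurableSpace G] [BorelSpace G]

/-- **Measurability of the plaquette defect** `U ↦ N − Re tr r(U_p)` on the torus configuration
space (product σ-algebra): `G` is second countable (the faithful `r.ρ` is a closed embedding into
`M_N(ℂ)`), so the holonomy is measurable, and `Re tr r` is continuous. -/
theorem measurable_defect (r : LatticeRep G) {N : ℕ} (p : Plaquette 4 N) :
    Measurable fun U : GaugeConfig 4 N G =>
      (r.N : ℝ) - (r.ρ (plaquetteHolonomy U p.1 p.2.1.1 p.2.1.2)).trace.re := by
  haveI : SecondCountableTopology G :=
    (r.continuous.isClosedEmbedding r.injective).isEmbedding.secondCountableTopology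
  exact measurable_const.sub
    ((continuous_trace_re r.ρ r.continuous).measurable.comp (measurable_plaquetteHolonomy _ _ _))

/-- **The large-field event of one plaquette is measurable**: `{U | ε₀ ≤ N − Re tr r(U_p)}`. -/
theorem measurableSet_largeField (r : LatticeRep G) (ε₀ : ℝ) {N : ℕ} (p : Plaquette 4 N) :
    MeasurableSet {U : GaugeConfig 4 N G |
      ε₀ ≤ (r.N : ℝ) - (r.ρ (plaquetteHolonomy U p.1 p.2.1.1 p.2.1.2)).trace.re} :=
  measurableSet_le measurable_const (measurable_defect r p)

omit [TopologicalSpace G] [IsTopologicalGroup G] [CompactSpace G] [MeasurableSpace G]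
  [BorelSpace G] in
/-- **Plaquette holonomies are read on the cell.** If the sites `y`, `y + eᵢ`, `y + eⱼ` of the
plaquette `p = (y, i < j)` carry the label `x`, then its four links `(y, i)`, `(y + eᵢ, j)`,
`(y + eⱼ, i)`, `(y, j)` are labelled `x` (`cellOf q (z, k) = siteCell q z`), so two configurations
agreeing on the links labelled `x` have the same holonomy around `p`. -/
theorem plaquetteHolonomy_congr_of_cell {N : ℕ} {μ : Fin 4 → ℕ}
    (q : (i : Fin 4) → ZMod N → ZMod (μ i + 1)) (x : CoarseIdx μ) (p : Plaquette 4 N)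
    (hp : siteCell q p.1 = x ∧ siteCell q (p.1.shift p.2.1.1) = x ∧
      siteCell q (p.1.shift p.2.1.2) = x)
    (U V : GaugeConfig 4 N G) (hUV : ∀ e, cellOf q e = x → U e = V e) :
    plaquetteHolonomy U p.1 p.2.1.1 p.2.1.2 = plaquetteHolonomy V p.1 p.2.1.1 p.2.1.2 := by
  obtain ⟨h₁, h₂, h₃⟩ := hp
  unfold plaquetteHolonomy
  rw [hUV (p.1, p.2.1.1) h₁, hUV (p.1.shift p.2.1.1, p.2.1.2) h₂,
    hUV (p.1.shift p.2.1.2, p.2.1.1) h₃, hUV (p.1, p.2.1.2) h₁]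

end StubLargeFieldCountEvent

open StubLargeFieldCountEvent in
/-- **Stub (M) `stub_largeFieldCountEvent`** (G-blind TOOL): for a finite plaquette set `P` all
of whose plaquettes have their links in the cell `x` of an axis-frame family `q`, the COUNT event
"at least `m` plaquettes of `P` are `ε₀`-large"
(`∃ Y ⊆ P, m ≤ |Y| ∧ ∀ p ∈ Y, N − Re tr r(U_p) ≥ ε₀`) is measurable (finite union of finite
intersections of measurable superlevel sets; `r.ρ` is continuous and the holonomy is measurable)
and is READ ON THE CELL `x` (two configurations agreeing on the links labelled `x` lie in it
together). These are the fields `good_meas` / `good_local` for count-type good events and the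
cover hypothesis of the union-bound stub (U). -/
theorem stub_largeFieldCountEvent :
    ∀ (G : Type) [Group G] [TopologicalSpace G] [IsTopologicalGroup G] [CompactSpace G]
      [MeasurableSpace G] [BorelSpace G] (r : LatticeRep G) (ε₀ : ℝ) {N : ℕ} {μ : Fin 4 → ℕ}
      (q : (i : Fin 4) → ZMod N → ZMod (μ i + 1)) (x : CoarseIdx μ) (P : Finset (Plaquette 4 N))
      (m : ℕ),
      (∀ p ∈ P, siteCell q p.1 = x ∧ siteCell q (p.1.shift p.2.1.1) = x ∧
          siteCell q (p.1.shift p.2.1.2) = x) →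
      MeasurableSet {U : GaugeConfig 4 N G | ∃ Y ⊆ P, m ≤ Y.card ∧ ∀ p ∈ Y,
          ε₀ ≤ (r.N : ℝ) - (r.ρ (plaquetteHolonomy U p.1 p.2.1.1 p.2.1.2)).trace.re} ∧
      ∀ U V : GaugeConfig 4 N G, (∀ e, cellOf q e = x → U e = V e) →
        ((∃ Y ⊆ P, m ≤ Y.card ∧ ∀ p ∈ Y,
            ε₀ ≤ (r.N : ℝ) - (r.ρ (plaquetteHolonomy U p.1 p.2.1.1 p.2.1.2)).trace.re) ↔
          (∃ Y ⊆ P, m ≤ Y.card ∧ ∀ p ∈ Y,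
            ε₀ ≤ (r.N : ℝ) - (r.ρ (plaquetteHolonomy V p.1 p.2.1.1 p.2.1.2)).trace.re)) := by
  intro G _ _ _ _ _ _ r ε₀ N μ q x P m hP
  refine ⟨measurableSet_count P m
      (fun p (U : GaugeConfig 4 N G) =>
        ε₀ ≤ (r.N : ℝ) - (r.ρ (plaquetteHolonomy U p.1 p.2.1.1 p.2.1.2)).trace.re)
      fun p _ => measurableSet_largeField r ε₀ p, fun U V hUV => ?_⟩
  exact exists_congr fun Y => and_congr_right fun hY => and_congr_right fun _ =>
    forall₂_congr fun p hp => by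
      rw [plaquetteHolonomy_congr_of_cell q x p (hP p (hY hp)) U V hUV]

end Summit.QuantumFields.YangMills.Cruxes.LatticeGapOnTrajectory.SparseDefectOrbitWindow
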